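import Summits.QuantumFields.BalabanUV.T4Continuum.Support.ScalarCovariantCoercive
import Summits.QuantumFields.BalabanUV.T4Continuum.Support.GaugeTermScalarData
import Summits.QuantumFields.BalabanUV.T4Continuum.Support.LineAveragingPairingLaw

/-!
# T⁴ programme, SUBSTRATE (shared lattice-gauge analysis library) — THE COVARIANT SCALAR BLOCK AVERAGING `Q′(U) = (Q′ ⊗ 1)·siteMul T`
# AND ITS ADJOINT: `Q′(U)Q′(U)ᴴ = n^{−d}·1` for unitary site transports, the covariant block-mean projector, the entry formulas of
# `Q′(U)` ∕ `Q′(U)ᴴ`, the reproduction of covariantly block-constant fields, and the COMPOSITION LAW of the [B9] (3.19) SHAPE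
# `Q′(T′)·Q′₀(T) = Q′(T′∘par · T)` (map item «block-averaging operator Q and its adjoint identities», V2 half)

Substrate cell `b2b-balaban-substrate-*`, seat p3 (focus: block-averaging `Q` adjoint identities).  The covariant scalar averaging of
[Balaban1985BackgroundPropagators] = [B9] (3.18)–(3.19) p.393 «(Q′(V)λ)(y) = Σ_{x∈B(y)} L^{−d}R(V(Γ_{y,x}))λ(x)», «Q′_j(U) = Q′(Ū^{j−1})·…·Q′(U)»
is typed in the tree as `ScalarCovariantLaplacian.QsCov n M T = (Q′ ⊗ 1)·siteMul T` (site transports `T(x) = R(V(Γ_{y,x}))` as DATA, p208899;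
0 consumers before this file) and, isometrically normalised, as `Bs o n M·siteMul T`, `Bs = √(n^d)·(Q′ ⊗ 1)` (the mass term of `scalarOp`).
The flat identities exist (`LineAveragingPairingLaw.QsOp_mul_conjTranspose` `Q′Q′ᴴ = n^{−d}·1`, `ScalarBlockPoincare.QsOp_conjTranspose_mulVec`,
`B5Blocks16.QsOp_blockConst`, `GaugeTermScalarData.QsOp_mul_Qavg0`); THIS FILE gives their COVARIANT counterparts, exact equalities for
every `n`, `M`, `o`:

 * §1 `siteMul_mul_conjTranspose_of_unitary` ∕ `conjTranspose_siteMul_mul_of_unitary` (unitary site transports give a unitary `siteMul`);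
   **`QsCov_mul_conjTranspose`** (general `T`: `Q′(U)Q′(U)ᴴ = (Q′ ⊗ 1)·siteMul(TTᴴ)·(Q′ ⊗ 1)ᴴ`) and **`QsCov_mul_conjTranspose_of_unitary`**:
   `Q′(U)·Q′(U)ᴴ = n^{−d}·1` — the transports DROP OUT ([B9] p.394 uses `Q′(U)Q′(U)*` invertible on the coarse lattice); normalised:
   **`Bsite_mul_conjTranspose_of_unitary`** `(B·siteMul T)(B·siteMul T)ᴴ = 1` (a co-isometry), whence the COVARIANT BLOCK-MEAN PROJECTOR
   `PiCov T := (B·siteMul T)ᴴ(B·siteMul T)` (= `siteMul(Tᴴ)·(Π′ ⊗ 1)·siteMul T`, `ScalarCovariantCoercive.gram_eq_sandwich`) is an orthogonal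
   projection: `PiCov_isHermitian`, **`PiCov_mul_self`**;
 * §2 entries: **`QsCov_mulVec_apply`** `(Q′(U)f)(y, a) = n^{−d}·Σ_{j}Σ_b T(ny+j)_{ab}f(ny+j, b)` and **`QsCov_conjTranspose_mulVec_apply`**
   `(Q′(U)ᴴg)(x, a) = n^{−d}·Σ_b conj(T(x)_{ba})·g(y_x, b)` (`y_x = blockOf x`): the adjoint INJECTS the coarse field into the block of `x` and
   transports it back by `T(x)ᴴ`;
 * §3 reproduction: the covariantly block-constant lift `covLift T g := n^d·Q′(U)ᴴg` satisfies **`QsCov_mulVec_covLift`** `Q′(U)(covLift T g) = g`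
   (unitary `T`) — the covariant twin of `B5Blocks16.QsOp_blockConst`; `PiCov_mulVec_covLift` (the lift is `PiCov`-invariant), `QsCov_mulVec_surjective`;
 * §4 THE COMPOSITION LAW (shape of (3.19)): with King's one-step averaging `Qavg0 N R M` (fine `η/R` → `η`, `ScalarBlockPlanting`) and its
   block map `par`, the intertwining `kron_Qavg0_mul_siteMul` (`(Q₀ ⊗ 1)·siteMul(T′∘par) = siteMul T′·(Q₀ ⊗ 1)`) and
   **`QsCov_mul_QsCov0`**: `((Q′_N ⊗ 1)·siteMul T′)·((Q₀ ⊗ 1)·siteMul T) = (Q′_{RN} ⊗ 1)·siteMul (x ↦ T′(par x)·T(x))` — composing covariant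
   averagings composes the transports along the nested blocks, exactly the structure of «Q′_j(U) = Q′(Ū^{j−1})…Q′(U)».

HONEST FRAMING (T4-DAG p. 1).  Exact linear algebra on the typed operators (transports are DATA; «unitary» is a hypothesis); nothing printed is
a hypothesis or a conclusion — (3.18)/(3.19) are cited for the SHAPE; no `def … : Prop` fact; spine 0/9 unchanged; NOT infinite volume ∕ mass
gap ∕ Clay.  HONEST DEPENDENCY: continuum YM on T⁴ ⇐ BetaPertH ∧ nine spine estimates (0/9 proved); BetaPertH ⇐ (D1) ∧ (D4) ∧ CAP+tail;
G-an2-4 gates asym, D1 and NE2/3/4.  ABSOLUTE RULE kept; no `sorry`.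
-/

noncomputable section

open scoped BigOperators ComplexConjugate Matrix Matrix.Norms.L2Operator Kronecker

namespace Summit.QuantumFields.BalabanUV.T4Continuum.ScalarCovariantAveragingAdjoint

open Literature.MathematicalPhysics.QuantumFieldTheory.Balaban1983to89.B5Prop11Plancherel (Tor fine unitVec)
open Literature.MathematicalPhysics.QuantumFieldTheory.Balaban1983to89.B5Block118 (QsOp bpt QsOp_mulVec)
open Literature.MathematicalPhysics.QuantumFieldTheory.Balaban1983to89.B5Blocks16 (blockOf blockOf_bpt bpt_bijective)
open Summit.QuantumFields.BalabanUV.T4Continuum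
open Summit.QuantumFields.BalabanUV.T4Continuum.KroneckerLift
open Summit.QuantumFields.BalabanUV.T4Continuum.BlockMultiplication
open Summit.QuantumFields.BalabanUV.T4Continuum.BalabanAveragedTowerModes (par)
open Summit.QuantumFields.BalabanUV.T4Continuum.ScalarBlockPlanting (Qavg0)
open Summit.QuantumFields.BalabanUV.T4Continuum.ScalarBlockPoincare (PiS QsOp_apply_blockOf QsOp_conjTranspose_mulVec)
open Summit.QuantumFields.BalabanUV.T4Continuum.ScalarCovariantLaplacian (QsCov Bs Bs_conjTranspose_mul_Bs)
open Summit.QuantumFields.BalabanUV.T4Continuum.ScalarCovariantCoercive (gram_eq_sandwich)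
open Summit.QuantumFields.BalabanUV.T4Continuum.LineAveragingPairing (QsOp_mul_conjTranspose)
open Summit.QuantumFields.BalabanUV.T4Continuum.GaugeTermScalarData (QsOp_mul_Qavg0)

variable {d : ℕ} {o : Type*} [Fintype o] [DecidableEq o]
variable (n : ℕ) [NeZero n] (M : Fin d → ℕ) [hM : ∀ μ, NeZero (M μ)]

/-! ## §1 `Q′(U)Q′(U)ᴴ`: the transports drop out; the covariant block-mean projector -/

section Adjoint

/-- unitary site transports give `siteMul T·(siteMul T)ᴴ = 1`. [folklore] -/
theorem siteMul_mul_conjTranspose_of_unitary {T : Tor (fine n M) → Matrix o o ℂ} (hT : ∀ x, T x ∈ Matrix.unitaryGroup o ℂ) :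
    siteMul T * (siteMul T)ᴴ = 1 := by
  rw [siteMul_conjTranspose, siteMul_mul, ← siteMul_one (ι := Tor (fine n M)) (o := o)]
  congr 1; funext x
  exact Matrix.mem_unitaryGroup_iff.mp (hT x)

/-- … and `(siteMul T)ᴴ·siteMul T = 1`. [folklore] -/
theorem conjTranspose_siteMul_mul_of_unitary {T : Tor (fine n M) → Matrix o o ℂ} (hT : ∀ x, T x ∈ Matrix.unitaryGroup o ℂ) :
    (siteMul T)ᴴ * siteMul T = 1 := by
  rw [siteMul_conjTranspose, siteMul_mul, ← siteMul_one (ι := Tor (fine n M)) (o := o)]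
  congr 1; funext x
  exact Matrix.mem_unitaryGroup_iff'.mp (hT x)

/-- the lifted flat identity `(Q′ ⊗ 1)(Q′ ⊗ 1)ᴴ = n^{−d}·1`. [folklore] -/
theorem QsOp_kron_mul_conjTranspose :
    QsOp n M ⊗ₖ (1 : Matrix o o ℂ) * (QsOp n M ⊗ₖ (1 : Matrix o o ℂ))ᴴ = (((n : ℂ) ^ d)⁻¹) • (1 : Matrix (Tor M × o) (Tor M × o) ℂ) := by
  rw [kron_conjTranspose, ← kron_mul, QsOp_mul_conjTranspose, Matrix.smul_kronecker, Matrix.one_kronecker_one]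

/-- **`Q′(U)Q′(U)ᴴ` for general transports**: `(Q′ ⊗ 1)·siteMul(T·Tᴴ)·(Q′ ⊗ 1)ᴴ`. [folklore] -/
theorem QsCov_mul_conjTranspose (T : Tor (fine n M) → Matrix o o ℂ) :
    QsCov n M T * (QsCov n M T)ᴴ
      = QsOp n M ⊗ₖ (1 : Matrix o o ℂ) * siteMul (fun x => T x * (T x)ᴴ) * (QsOp n M ⊗ₖ (1 : Matrix o o ℂ))ᴴ := by
  rw [QsCov, Matrix.conjTranspose_mul, siteMul_conjTranspose, Matrix.mul_assoc, ← Matrix.mul_assoc (siteMul T), siteMul_mul,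
    Matrix.mul_assoc]

/-- **`Q′(U)·Q′(U)ᴴ = n^{−d}·1` FOR UNITARY SITE TRANSPORTS** — the transports drop out of `Q′(U)Q′(U)*`.
[cite: Balaban1985BackgroundPropagators, (3.19) p.393 (shape)] [folklore] -/
theorem QsCov_mul_conjTranspose_of_unitary {T : Tor (fine n M) → Matrix o o ℂ} (hT : ∀ x, T x ∈ Matrix.unitaryGroup o ℂ) :
    QsCov n M T * (QsCov n M T)ᴴ = (((n : ℂ) ^ d)⁻¹) • (1 : Matrix (Tor M × o) (Tor M × o) ℂ) := by
  rw [QsCov, Matrix.conjTranspose_mul, Matrix.mul_assoc, ← Matrix.mul_assoc (siteMul T) (siteMul T)ᴴ, siteMul_mul_conjTranspose_of_unitary n M hT,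
    Matrix.one_mul, QsOp_kron_mul_conjTranspose]

variable (o) in
/-- `B·Bᴴ = 1` (`B = √(n^d)·(Q′ ⊗ 1)` is a co-isometry). [folklore] -/
theorem Bs_mul_conjTranspose : Bs o n M * (Bs o n M)ᴴ = 1 := by
  have hn : ((n : ℂ) ^ d) ≠ 0 := pow_ne_zero _ (by exact_mod_cast NeZero.ne n)
  have hs : star ((((Real.sqrt ((n : ℝ) ^ d)) : ℝ) : ℂ)) = (((Real.sqrt ((n : ℝ) ^ d)) : ℝ) : ℂ) := Complex.conj_ofReal _
  have hss : ((((Real.sqrt ((n : ℝ) ^ d)) : ℝ) : ℂ)) * (((Real.sqrt ((n : ℝ) ^ d)) : ℝ) : ℂ) = ((n : ℂ)) ^ d := by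
    rw [← Complex.ofReal_mul, Real.mul_self_sqrt (pow_nonneg (Nat.cast_nonneg _) d)]; push_cast; rfl
  rw [Bs, Matrix.conjTranspose_smul, hs, Matrix.smul_mul, Matrix.mul_smul, smul_smul, hss, QsOp_kron_mul_conjTranspose, smul_smul,
    mul_inv_cancel₀ hn, one_smul]

/-- **`(B·siteMul T)·(B·siteMul T)ᴴ = 1`** for unitary site transports: the normalised covariant averaging is a co-isometry. [folklore] -/
theorem Bsite_mul_conjTranspose_of_unitary {T : Tor (fine n M) → Matrix o o ℂ} (hT : ∀ x, T x ∈ Matrix.unitaryGroup o ℂ) :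
    (Bs o n M * siteMul T) * (Bs o n M * siteMul T)ᴴ = 1 := by
  rw [Matrix.conjTranspose_mul, Matrix.mul_assoc, ← Matrix.mul_assoc (siteMul T) (siteMul T)ᴴ, siteMul_mul_conjTranspose_of_unitary n M hT,
    Matrix.one_mul, Bs_mul_conjTranspose]

/-- **THE COVARIANT BLOCK-MEAN PROJECTOR** `Π_U = (B·siteMul T)ᴴ(B·siteMul T)` (= `n^d·Q′(U)ᴴQ′(U)` = `siteMul(Tᴴ)·(Π′ ⊗ 1)·siteMul T`). [folklore] -/
def PiCov (T : Tor (fine n M) → Matrix o o ℂ) : Matrix (Tor (fine n M) × o) (Tor (fine n M) × o) ℂ :=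
  (Bs o n M * siteMul T)ᴴ * (Bs o n M * siteMul T)

/-- `Π_U = siteMul(Tᴴ)·(Π′ ⊗ 1)·siteMul T`. [folklore] -/
theorem PiCov_eq_sandwich (T : Tor (fine n M) → Matrix o o ℂ) :
    PiCov n M T = siteMul (fun x => (T x)ᴴ) * (PiS n M ⊗ₖ (1 : Matrix o o ℂ)) * siteMul T := gram_eq_sandwich n M T

/-- `Π_U` is Hermitian. [folklore] -/
theorem PiCov_isHermitian (T : Tor (fine n M) → Matrix o o ℂ) : (PiCov n M T).IsHermitian := by
  unfold Matrix.IsHermitian PiCov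
  rw [Matrix.conjTranspose_mul, Matrix.conjTranspose_conjTranspose]

/-- **`Π_U² = Π_U`** for unitary site transports (co-isometry ⟹ the Gram is a projection). [folklore] -/
theorem PiCov_mul_self {T : Tor (fine n M) → Matrix o o ℂ} (hT : ∀ x, T x ∈ Matrix.unitaryGroup o ℂ) :
    PiCov n M T * PiCov n M T = PiCov n M T := by
  unfold PiCov
  rw [Matrix.mul_assoc, ← Matrix.mul_assoc (Bs o n M * siteMul T) ((Bs o n M * siteMul T)ᴴ), Bsite_mul_conjTranspose_of_unitary n M hT,
    Matrix.one_mul]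

/-- at `T = 1`: `Π_1 = Π′ ⊗ 1`. [folklore] -/
theorem PiCov_one : PiCov n M (fun _ : Tor (fine n M) => (1 : Matrix o o ℂ)) = PiS n M ⊗ₖ (1 : Matrix o o ℂ) := by
  rw [PiCov, siteMul_one, Matrix.mul_one, Bs_conjTranspose_mul_Bs]

end Adjoint

/-! ## §2 Entry formulas: `Q′(U)` averages the transported field over the block, `Q′(U)ᴴ` injects and transports back -/

section Entries

/-- **`(Q′(U)f)(y, a) = n^{−d}·Σ_{j}Σ_b T(ny + j)_{ab}·f(ny + j, b)`**. [cite: Balaban1985BackgroundPropagators, (3.18) p.393 (shape)] [folklore] -/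
theorem QsCov_mulVec_apply (T : Tor (fine n M) → Matrix o o ℂ) (f : Tor (fine n M) × o → ℂ) (y : Tor M) (a : o) :
    (QsCov n M T *ᵥ f) (y, a) = 1 / ((n : ℕ) : ℂ) ^ d * ∑ j : Fin d → Fin n, ∑ b, T (bpt n M y j) a b * f (bpt n M y j, b) := by
  rw [QsCov, ← Matrix.mulVec_mulVec]
  -- the inner vector: `(siteMul T f)(x, a) = Σ_b T(x)_{ab} f(x, b)`
  have hinner : ∀ x : Tor (fine n M), (siteMul T *ᵥ f) (x, a) = ∑ b, T x a b * f (x, b) := by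
    intro x
    rw [Matrix.mulVec, dotProduct, Fintype.sum_prod_type, Finset.sum_eq_single x]
    · exact Finset.sum_congr rfl fun b _ => by rw [siteMul_apply, if_pos rfl]
    · intro x' _ hx'; exact Finset.sum_eq_zero fun b _ => by rw [siteMul_apply, if_neg (Ne.symm hx'), zero_mul]
    · intro h; exact absurd (Finset.mem_univ _) h
  -- the outer average: `((Q′ ⊗ 1)g)(y, a) = (Q′ g(·, a))(y)`
  rw [Matrix.mulVec, dotProduct, Fintype.sum_prod_type]
  have hkron : ∀ x : Tor (fine n M), ∑ b : o, (QsOp n M ⊗ₖ (1 : Matrix o o ℂ)) (y, a) (x, b) * (siteMul T *ᵥ f) (x, b)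
      = QsOp n M y x * (siteMul T *ᵥ f) (x, a) := by
    intro x
    rw [Finset.sum_eq_single a]
    · rw [Matrix.kroneckerMap_apply, Matrix.one_apply_eq, mul_one]
    · intro b _ hb; rw [Matrix.kroneckerMap_apply, Matrix.one_apply_ne (Ne.symm hb), mul_zero, zero_mul]
    · intro h; exact absurd (Finset.mem_univ _) h
  simp_rw [hkron, hinner]
  have h := QsOp_mulVec n M (fun x => ∑ b, T x a b * f (x, b)) y
  rw [Matrix.mulVec, dotProduct] at h
  rw [h]

/-- **`(Q′(U)ᴴg)(x, a) = n^{−d}·Σ_b conj(T(x)_{ba})·g(y_x, b)`** (`y_x = blockOf x`): inject into the block, transport back by `T(x)ᴴ`. [folklore] -/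
theorem QsCov_conjTranspose_mulVec_apply (T : Tor (fine n M) → Matrix o o ℂ) (g : Tor M × o → ℂ) (x : Tor (fine n M)) (a : o) :
    ((QsCov n M T)ᴴ *ᵥ g) (x, a) = 1 / ((n : ℕ) : ℂ) ^ d * ∑ b, star (T x b a) * g (blockOf n M x, b) := by
  rw [QsCov, Matrix.conjTranspose_mul, ← Matrix.mulVec_mulVec, siteMul_conjTranspose, kron_conjTranspose]
  rw [Matrix.mulVec, dotProduct, Fintype.sum_prod_type, Finset.sum_eq_single x]
  · rw [Finset.mul_sum]
    refine Finset.sum_congr rfl fun b _ => ?_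
    rw [siteMul_apply, if_pos rfl, Matrix.conjTranspose_apply]
    -- `((Q′ᴴ ⊗ 1)g)(x, b) = (Q′ᴴ g(·, b))(x) = n^{−d} g(blockOf x, b)`
    have hk : ((QsOp n M)ᴴ ⊗ₖ (1 : Matrix o o ℂ) *ᵥ g) (x, b) = ((QsOp n M)ᴴ *ᵥ fun y => g (y, b)) x := by
      rw [Matrix.mulVec, dotProduct, Fintype.sum_prod_type, Matrix.mulVec, dotProduct]
      refine Finset.sum_congr rfl fun y _ => ?_
      rw [Finset.sum_eq_single b]
      · rw [Matrix.kroneckerMap_apply, Matrix.one_apply_eq, mul_one]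
      · intro b' _ hb'; rw [Matrix.kroneckerMap_apply, Matrix.one_apply_ne (Ne.symm hb'), mul_zero, zero_mul]
      · intro h; exact absurd (Finset.mem_univ _) h
    rw [hk, QsOp_conjTranspose_mulVec]
    ring
  · intro x' _ hx'
    exact Finset.sum_eq_zero fun b _ => by rw [siteMul_apply, if_neg (Ne.symm hx'), zero_mul]
  · intro h; exact absurd (Finset.mem_univ _) h

end Entries

/-! ## §3 Reproduction of covariantly block-constant fields -/

section Reproduction

/-- **the covariantly block-constant lift** of a coarse field: `covLift T g = n^d·Q′(U)ᴴg`, i.e. `(covLift T g)(x) = T(x)ᴴ·g(y_x)`. [folklore] -/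
def covLift (T : Tor (fine n M) → Matrix o o ℂ) (g : Tor M × o → ℂ) : Tor (fine n M) × o → ℂ :=
  (((n : ℂ) ^ d)) • ((QsCov n M T)ᴴ *ᵥ g)

/-- the lift, entrywise: `(covLift T g)(x, a) = Σ_b conj(T(x)_{ba})·g(y_x, b) = (T(x)ᴴ g(y_x))_a`. [folklore] -/
theorem covLift_apply (T : Tor (fine n M) → Matrix o o ℂ) (g : Tor M × o → ℂ) (x : Tor (fine n M)) (a : o) :
    covLift n M T g (x, a) = ∑ b, star (T x b a) * g (blockOf n M x, b) := by
  have hn : ((n : ℂ) ^ d) ≠ 0 := pow_ne_zero _ (by exact_mod_cast NeZero.ne n)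
  rw [covLift, Pi.smul_apply, QsCov_conjTranspose_mulVec_apply, smul_eq_mul, ← mul_assoc, one_div]
  rw [show ((n : ℂ) ^ d) * ((((n : ℕ) : ℂ)) ^ d)⁻¹ = 1 from mul_inv_cancel₀ hn, one_mul]

/-- **REPRODUCTION**: `Q′(U)(covLift T g) = g` for unitary site transports — the covariant twin of `B5Blocks16.QsOp_blockConst`.
[cite: Balaban1985BackgroundPropagators, (3.19) p.393 (shape)] [folklore] -/
theorem QsCov_mulVec_covLift {T : Tor (fine n M) → Matrix o o ℂ} (hT : ∀ x, T x ∈ Matrix.unitaryGroup o ℂ) (g : Tor M × o → ℂ) :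
    QsCov n M T *ᵥ covLift n M T g = g := by
  have hn : ((n : ℂ) ^ d) ≠ 0 := pow_ne_zero _ (by exact_mod_cast NeZero.ne n)
  rw [covLift, Matrix.mulVec_smul, Matrix.mulVec_mulVec, QsCov_mul_conjTranspose_of_unitary n M hT, Matrix.smul_mulVec, Matrix.one_mulVec,
    smul_smul, mul_inv_cancel₀ hn, one_smul]

/-- `Q′(U)` is onto (unitary transports): every coarse field is the average of its covariant lift. [folklore] -/
theorem QsCov_mulVec_surjective {T : Tor (fine n M) → Matrix o o ℂ} (hT : ∀ x, T x ∈ Matrix.unitaryGroup o ℂ) :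
    Function.Surjective (QsCov n M T).mulVec := fun g => ⟨covLift n M T g, QsCov_mulVec_covLift n M hT g⟩

/-- the lift is fixed by the covariant block-mean projector: `Π_U(covLift T g) = covLift T g` (unitary `T`). [folklore] -/
theorem PiCov_mulVec_covLift {T : Tor (fine n M) → Matrix o o ℂ} (hT : ∀ x, T x ∈ Matrix.unitaryGroup o ℂ) (g : Tor M × o → ℂ) :
    PiCov n M T *ᵥ covLift n M T g = covLift n M T g := by
  -- `Π_U = n^d·Q′(U)ᴴQ′(U)` and `Q′(U)(covLift g) = g`
  have hB : Bs o n M * siteMul T = (((Real.sqrt ((n : ℝ) ^ d)) : ℝ) : ℂ) • QsCov n M T := by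
    rw [Bs, Matrix.smul_mul, QsCov]
  have hss : star ((((Real.sqrt ((n : ℝ) ^ d)) : ℝ) : ℂ)) * (((Real.sqrt ((n : ℝ) ^ d)) : ℝ) : ℂ) = ((n : ℂ)) ^ d := by
    rw [Complex.star_def, Complex.conj_ofReal, ← Complex.ofReal_mul, Real.mul_self_sqrt (pow_nonneg (Nat.cast_nonneg _) d)]; push_cast; rfl
  rw [PiCov, hB, Matrix.conjTranspose_smul, Matrix.smul_mul, Matrix.mul_smul, smul_smul, hss, Matrix.smul_mulVec, ← Matrix.mulVec_mulVec,
    QsCov_mulVec_covLift n M hT, covLift]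

end Reproduction

/-! ## §4 The composition law of the (3.19) shape -/

section Composition

variable (N R : ℕ) [NeZero N] [NeZero R]

/-- **intertwining**: a family that is constant on the `R`-blocks passes through King's one-step averaging,
`(Q₀ ⊗ 1)·siteMul(T′∘par) = siteMul T′·(Q₀ ⊗ 1)`. [folklore] -/
theorem kron_Qavg0_mul_siteMul (T' : Tor (fine N M) → Matrix o o ℂ) :
    Qavg0 N R M ⊗ₖ (1 : Matrix o o ℂ) * siteMul (fun x => T' (par N R M x)) = siteMul T' * Qavg0 N R M ⊗ₖ (1 : Matrix o o ℂ) := by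
  refine kron_mul_siteMul_eq fun y x hyx => ?_
  have : par N R M x = y := by
    by_contra h; exact hyx (by rw [Qavg0, if_neg h])
  rw [this]

/-- **THE COMPOSITION LAW** (shape of [B9] (3.19) «Q′_j(U) = Q′(Ū^{j−1})·…·Q′(U)»): composing the covariant averaging over `N`-blocks with
transports `T′` after King's one-step averaging over `R`-blocks with transports `T` IS the covariant averaging over `RN`-blocks with the
COMPOSED transports `x ↦ T′(par x)·T(x)`. [cite: Balaban1985BackgroundPropagators, (3.19) p.393 (shape)] [folklore] -/
theorem QsCov_mul_QsCov0 (T' : Tor (fine N M) → Matrix o o ℂ) (T : Tor (fine (R * N) M) → Matrix o o ℂ) :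
    (QsOp N M ⊗ₖ (1 : Matrix o o ℂ) * siteMul T') * (Qavg0 N R M ⊗ₖ (1 : Matrix o o ℂ) * siteMul T)
      = QsOp (R * N) M ⊗ₖ (1 : Matrix o o ℂ) * siteMul (fun x => T' (par N R M x) * T x) := by
  rw [Matrix.mul_assoc, ← Matrix.mul_assoc (siteMul T'), ← kron_Qavg0_mul_siteMul M N R T', Matrix.mul_assoc, siteMul_mul, ← Matrix.mul_assoc,
    ← kron_mul, QsOp_mul_Qavg0]

omit hM [NeZero N] [NeZero R] in
/-- the composed transports are unitary when both factors are. [folklore] -/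
theorem comp_transport_unitary {T' : Tor (fine N M) → Matrix o o ℂ} {T : Tor (fine (R * N) M) → Matrix o o ℂ}
    (hT' : ∀ y, T' y ∈ Matrix.unitaryGroup o ℂ) (hT : ∀ x, T x ∈ Matrix.unitaryGroup o ℂ) (x : Tor (fine (R * N) M)) :
    T' (par N R M x) * T x ∈ Matrix.unitaryGroup o ℂ :=
  Submonoid.mul_mem _ (hT' _) (hT x)

end Composition

end Summit.QuantumFields.BalabanUV.T4Continuum.ScalarCovariantAveragingAdjoint

end
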